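import Summits.CriticalPhenomena.PercolationContinuityZ3.Theorems.SahiCISDefinitionFourReduction

/-!
# Colangelo–Müller–Scarsini's Definition 4 in dimension `≥ 3`: two further scope facts — II: the examples

Cell `prim-sahi`, literature seat (generation 29; landed by the typer seat, generation 17, Theorems/ being prover-only;
part I = `SahiCISDefinitionFourReduction.lean`: `natAtomic`, the finite reduction `condIncrGiven_natAtomic(_of_bits)`);
`--supports stmt-CriticalPhenomena-4575`.  No named facts, no sorries; the combinatorial core is a kernel computation
(`decide`).

* **(c) ⇏ (a) in Theorem 4, `d = 3`** (`cmsExampleC` = `δ_{(0,0,1)} + δ_{(1,0,0)}`, twice the law of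
  `(ξ, 0, 1 − ξ)`, `ξ` a fair coin): `isCISc_cmsExampleC` and `not_isCIS_cmsExampleC`; `exists_isCISc_not_isCIS`.
  Consequently the printed proof of Theorem 5, which passes through (c), establishes the weak closure of the
  interval form (c) only (`IsCISc.of_tendsto` in the Literature file).
* **CI in the sense of Definition 4 does not imply positive association, `d = 4`** (`cmsExampleCI` = the law
  `(3 δ_{0000} + 2 δ_{0011} + 6 δ_{1010} + 2 δ_{1100} + 6 δ_{1111}) / 19` on `ℝ⁴`): `condIncrGiven_cmsExampleCI`
  (Definition 4 given EVERY set of conditioning coordinates, by the finite reduction and `decide`),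
  `isCIS_cmsExampleCI_perm` (Definition-4-CI), `not_isPositivelyAssociated_cmsExampleCI`
  (`µ(U) µ(V) = 120/361 > 114/361 = µ(U ∩ V)`), `exists_def4CI_not_isPositivelyAssociated`.  Classically CI ⇒ CIS ⇒
  associated (Müller–Stoyan Thm. 3.10.11); so the symmetrised Definition 4 is not the classical CI either, and a
  Definition-4-CI law need not be Sahi-positive even at order 2 (contrast `SahiCISPositivity.lean` for `IsCISae`).

Both examples were first found/checked by exact enumeration (cell HOME `code/lit/def4ci_exact.py`,
`code/lit/def4ci_indep.py`); this file is the kernel check.  References: Colangelo–Müller–Scarsini, J. Appl. Probab.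
43 (2006) 48–59, §4 Def. 4, Thm. 4, Thm. 5 [ColangeloMullerScarsini2006]; Müller–Stoyan 2002, Def. 3.10.9, Thm. 3.10.11
[MullerStoyan2002].
-/

noncomputable section

namespace Summit.CriticalPhenomena.PercolationContinuityZ3.Theorems.SahiCIS

open MeasureTheory Set
open Literature.Probability.LatticeModels.ConditionallyIncreasing
open Literature.Probability.Percolation (IsPositivelyAssociated)
open scoped ENNReal

/-! ### (c) ⇏ (a) in Theorem 4, `d = 3`: the law of `(ξ, 0, 1 − ξ)` -/

section IntervalForm

/-- Coordinates of the two atoms `(0,0,1)`, `(1,0,0)`. [this work] -/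
def bC : Fin 2 → Fin 3 → ℕ := ![![0, 0, 1], ![1, 0, 0]]

/-- Unit weights. [this work] -/
def wC : Fin 2 → ℕ := fun _ => 1

/-- **The example** `δ_{(0,0,1)} + δ_{(1,0,0)}` on `ℝ³` — twice the law of `(ξ, 0, 1 − ξ)`, `ξ` a fair coin
(Definition 4 and form (c) are homogeneous in `µ`). [this work] -/
def cmsExampleC : Measure (Fin 3 → ℝ) := natAtomic bC wC

/-- Both atoms have second coordinate `0`. [this work] -/
theorem pt_bC_apply_one (k : Fin 2) : pt bC k 1 = 0 := by
  fin_cases k <;> simp [bC]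

/-- The ray `{x₁ ≥ t}` is conull for `t ≤ 0`. [this work] -/
theorem cmsExampleC_ray_compl_eq_zero {t : ℝ} (ht : t ≤ 0) : cmsExampleC {x : Fin 3 → ℝ | t ≤ x 1}ᶜ = 0 := by
  refine natAtomic_eq_zero_of_forall_notMem _ _
    (measurableSet_le measurable_const (measurable_pi_apply 1)).compl fun k hk => ?_
  simp only [Set.mem_compl_iff, Set.mem_setOf_eq, pt_bC_apply_one, not_le] at hk
  exact absurd hk (not_lt.2 ht)

/-- The ray `{x₁ ≥ t}` is null for `t > 0`. [this work] -/
theorem cmsExampleC_ray_eq_zero {t : ℝ} (ht : 0 < t) : cmsExampleC {x : Fin 3 → ℝ | t ≤ x 1} = 0 := by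
  refine natAtomic_eq_zero_of_forall_notMem _ _
    (measurableSet_le measurable_const (measurable_pi_apply 1)) fun k hk => ?_
  simp only [Set.mem_setOf_eq, pt_bC_apply_one] at hk
  exact absurd hk (not_le.2 ht)

/-- **The example satisfies the interval form (c) of Theorem 4** (`IsCISc`). [this work] -/
theorem isCISc_cmsExampleC : IsCISc cmsExampleC := by
  intro k
  have hk : k = 0 ∨ k = 1 ∨ k = 2 := by fin_cases k <;> decide
  rcases hk with rfl | rfl | rfl
  · -- k = 0: no conditioning coordinate, both boxes are everything
    intro a c a' c' _ t
    have hJ : (Finset.univ.filter fun i : Fin 3 => i < 0) = ∅ := by decide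
    have hbox : ∀ a c : Fin 3 → ℝ, cylBox (Finset.univ.filter fun i : Fin 3 => i < 0) a c = univ := by
      intro a c; rw [hJ]; ext x; simp [cylBox]
    rw [hbox, hbox, Set.univ_inter]
  · -- k = 1: the response coordinate X₁ is constant (= 0)
    intro a c a' c' _ t
    by_cases ht : t ≤ 0
    · rw [measure_inter_conull (cmsExampleC_ray_compl_eq_zero ht),
        measure_inter_conull (cmsExampleC_ray_compl_eq_zero ht)]
      exact le_of_eq (mul_comm _ _)
    · rw [measure_mono_null Set.inter_subset_right (cmsExampleC_ray_eq_zero (lt_of_not_ge ht)), zero_mul]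
      exact bot_le
  · -- k = 2: the conditioning atoms (0,0), (1,0) share the coordinate 1, so `A < B` cannot charge both boxes
    intro a c a' c' hlt t
    have h1J : (1 : Fin 3) ∈ (Finset.univ.filter fun i : Fin 3 => i < 2) := by decide
    by_cases hA0 : cmsExampleC (cylBox (Finset.univ.filter fun i : Fin 3 => i < 2) a c) = 0
    · rw [measure_mono_null Set.inter_subset_left hA0, zero_mul]; exact bot_le
    by_cases hB0 : cmsExampleC (cylBox (Finset.univ.filter fun i : Fin 3 => i < 2) a' c') = 0
    · rw [hB0, mul_zero]; exact bot_le
    exfalso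
    obtain ⟨k, hk⟩ := exists_pt_mem_of_natAtomic_ne_zero _ _ (measurableSet_cylBox _ a c) hA0
    obtain ⟨k', hk'⟩ := exists_pt_mem_of_natAtomic_ne_zero _ _ (measurableSet_cylBox _ a' c') hB0
    have h1 := (hk 1 h1J).2
    have h2 := (hk' 1 h1J).1
    rw [pt_bC_apply_one] at h1 h2
    have h3 := hlt 1 h1J
    linarith

/-- `µ{x₂ > ½} = 1` (the atom `(0,0,1)`). [this work] -/
theorem cmsExampleC_ray_two : cmsExampleC {x : Fin 3 → ℝ | (2⁻¹ : ℝ) < x 2} = 1 := by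
  classical
  rw [cmsExampleC, natAtomic_apply_filter _ _ (measurableSet_lt measurable_const (measurable_pi_apply 2))]
  have hf : (Finset.univ.filter fun k => pt bC k ∈ {x : Fin 3 → ℝ | (2⁻¹ : ℝ) < x 2}) =
      Finset.univ.filter fun k => 1 ≤ bC k 2 :=
    Finset.filter_congr fun k _ => by simp only [Set.mem_setOf_eq, pt_apply, half_lt_natCast_iff]
  have hs : (∑ k ∈ Finset.univ.filter (fun k => 1 ≤ bC k 2), wC k) = 1 := by decide
  rw [hf, hs, Nat.cast_one]

/-- `µ{x₀ > ½} = 1` (the atom `(1,0,0)`). [this work] -/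
theorem cmsExampleC_ray_zero : cmsExampleC {x : Fin 3 → ℝ | (2⁻¹ : ℝ) < x 0} = 1 := by
  classical
  rw [cmsExampleC, natAtomic_apply_filter _ _ (measurableSet_lt measurable_const (measurable_pi_apply 0))]
  have hf : (Finset.univ.filter fun k => pt bC k ∈ {x : Fin 3 → ℝ | (2⁻¹ : ℝ) < x 0}) =
      Finset.univ.filter fun k => 1 ≤ bC k 0 :=
    Finset.filter_congr fun k _ => by simp only [Set.mem_setOf_eq, pt_apply, half_lt_natCast_iff]
  have hs : (∑ k ∈ Finset.univ.filter (fun k => 1 ≤ bC k 0), wC k) = 1 := by decide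
  rw [hf, hs, Nat.cast_one]

/-- `µ({x₂ > ½} ∩ {x₀ > ½}) = 0`. [this work] -/
theorem cmsExampleC_ray_two_inter_zero :
    cmsExampleC ({x : Fin 3 → ℝ | (2⁻¹ : ℝ) < x 2} ∩ {x | (2⁻¹ : ℝ) < x 0}) = 0 := by
  classical
  rw [cmsExampleC, natAtomic_apply_filter _ _ ((measurableSet_lt measurable_const (measurable_pi_apply 2)).inter
    (measurableSet_lt measurable_const (measurable_pi_apply 0)))]
  have hf : (Finset.univ.filter fun k => pt bC k ∈ {x : Fin 3 → ℝ | (2⁻¹ : ℝ) < x 2} ∩ {x | (2⁻¹ : ℝ) < x 0}) =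
      Finset.univ.filter fun k => 1 ≤ bC k 2 ∧ 1 ≤ bC k 0 :=
    Finset.filter_congr fun k _ => by
      simp only [Set.mem_inter_iff, Set.mem_setOf_eq, pt_apply, half_lt_natCast_iff]
  have hs : (∑ k ∈ Finset.univ.filter (fun k => 1 ≤ bC k 2 ∧ 1 ≤ bC k 0), wC k) = 0 := by decide
  rw [hf, hs, Nat.cast_zero]

/-- `µ(ℝ³) = 2`. [this work] -/
theorem cmsExampleC_univ : cmsExampleC univ = 2 := by
  rw [cmsExampleC, natAtomic_univ]
  have hs : (∑ k, wC k) = 2 := by decide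
  rw [hs]; norm_num

/-- **… but it is not CIS in the sense of Definition 4** (`IsCIS`): at `k = 1`, Definition 4 given `X₀` would
make `X₀` positively dependent on the increasing event `{x₂ > ½}` (B1, `CondIncrGiven.pqd`), whereas
`µ{x₂ > ½} µ{x₀ > ½} = 1 · 1 > 0 · 2 = µ({x₂ > ½} ∩ {x₀ > ½}) µ(ℝ³)`. [this work] -/
theorem not_isCIS_cmsExampleC : ¬ IsCIS cmsExampleC := by
  intro h
  have hJ : (Finset.univ.filter fun i : Fin 3 => i < 1) = {0} := by decide
  have h1 : CondIncrGiven cmsExampleC {(0 : Fin 3)} := by rw [← hJ]; exact h 1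
  have hp := h1.pqd 2 2⁻¹ 2⁻¹
  rw [cmsExampleC_ray_two, cmsExampleC_ray_zero, cmsExampleC_ray_two_inter_zero, cmsExampleC_univ] at hp
  norm_num at hp

/-- **Theorem 4 (c) ⇒ (a) fails as printed for `d = 3`**: an explicit finite law satisfying the interval form (c)
(`IsCISc`) that is not CIS in the sense of Definition 4 (`IsCIS`). [this work] -/
theorem exists_isCISc_not_isCIS : ∃ μ : Measure (Fin 3 → ℝ), IsFiniteMeasure μ ∧ IsCISc μ ∧ ¬ IsCIS μ :=
  ⟨cmsExampleC, isFiniteMeasure_natAtomic _ _, isCISc_cmsExampleC, not_isCIS_cmsExampleC⟩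

end IntervalForm

/-! ### Definition-4-CI does not imply positive association, `d = 4` -/

section NotAssociated

/-- Coordinates of the five atoms `0000, 0011, 1010, 1100, 1111`. [this work] -/
def bCI : Fin 5 → Fin 4 → ℕ := ![![0, 0, 0, 0], ![0, 0, 1, 1], ![1, 0, 1, 0], ![1, 1, 0, 0], ![1, 1, 1, 1]]

/-- Their weights `3, 2, 6, 2, 6` (total `19`). [this work] -/
def wCI : Fin 5 → ℕ := ![3, 2, 6, 2, 6]

/-- The unnormalised example `3 δ_{0000} + 2 δ_{0011} + 6 δ_{1010} + 2 δ_{1100} + 6 δ_{1111}` on `ℝ⁴`.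
[this work] -/
def cmsExampleCI₀ : Measure (Fin 4 → ℝ) := natAtomic bCI wCI

/-- **The example**: the probability law `(3 δ_{0000} + 2 δ_{0011} + 6 δ_{1010} + 2 δ_{1100} + 6 δ_{1111}) / 19`
on `ℝ⁴`. [this work] -/
def cmsExampleCI : Measure (Fin 4 → ℝ) := (19 : ℝ≥0∞)⁻¹ • cmsExampleCI₀

/-- Total mass of the unnormalised example is `19`. [this work] -/
theorem cmsExampleCI₀_univ : cmsExampleCI₀ univ = 19 := by
  rw [cmsExampleCI₀, natAtomic_univ]
  have hs : (∑ k, wCI k) = 19 := by decide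
  rw [hs]; norm_num

/-- The example is a probability measure. [this work] -/
instance isProbabilityMeasure_cmsExampleCI : IsProbabilityMeasure cmsExampleCI :=
  ⟨by
    rw [cmsExampleCI, Measure.smul_apply, smul_eq_mul, cmsExampleCI₀_univ]
    exact ENNReal.inv_mul_cancel (by norm_num) (by norm_num)⟩

/-- **The fibre-pair inequalities hold for every up-closed set of atoms, every set `J` of conditioning
coordinates and every strictly `J`-separated pair of atoms** (kernel computation: `32` bitmasks of which `10`
are up-closed, `16` conditioning sets, `25` pairs). [this work] -/
theorem cmsExampleCI_bits : ∀ m < 2 ^ 5, upClosedBits bCI m = true →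
    ∀ J : Finset (Fin 4), ∀ k₀ k₁ : Fin 5, sepBits bCI J k₀ k₁ = true → fpIneqBits bCI wCI m J k₀ k₁ = true := by
  decide

/-- **Definition 4 given every set `J` of conditioning coordinates** holds for the example. [this work] -/
theorem condIncrGiven_cmsExampleCI (J : Finset (Fin 4)) : CondIncrGiven cmsExampleCI J :=
  condIncrGiven_smul (condIncrGiven_natAtomic_of_bits bCI wCI J
    fun m hm hup k₀ k₁ hs => cmsExampleCI_bits m hm hup J k₀ k₁ hs) _

/-- Hence **the example is CIS in the sense of Definition 4 after every permutation of the coordinates**, i.e.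
CI in the sense of Colangelo–Müller–Scarsini's Definition 4. [this work] -/
theorem isCIS_cmsExampleCI_perm (σ : Equiv.Perm (Fin 4)) :
    IsCIS (cmsExampleCI.map fun (x : Fin 4 → ℝ) (i : Fin 4) => x (σ i)) :=
  isCIS_map_perm_of_forall_condIncrGiven condIncrGiven_cmsExampleCI σ

/-- In particular it is CIS in the sense of Definition 4 (identity permutation). [this work] -/
theorem isCIS_cmsExampleCI : IsCIS cmsExampleCI := fun _ => condIncrGiven_cmsExampleCI _

/-- The increasing event `U = {x₀ > ½, x₂ > ½}`. [this work] -/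
def evU : Set (Fin 4 → ℝ) := {x | (2⁻¹ : ℝ) < x 0 ∧ (2⁻¹ : ℝ) < x 2}

/-- The increasing event `V = {x₂ > ½, x₃ > ½} ∪ {x₀ > ½, x₁ > ½}`. [this work] -/
def evV : Set (Fin 4 → ℝ) := {x | ((2⁻¹ : ℝ) < x 2 ∧ (2⁻¹ : ℝ) < x 3) ∨ ((2⁻¹ : ℝ) < x 0 ∧ (2⁻¹ : ℝ) < x 1)}

/-- `U` is increasing. [this work] -/
theorem isUpperSet_evU : IsUpperSet evU := fun _ _ hxy hx =>
  ⟨lt_of_lt_of_le hx.1 (hxy 0), lt_of_lt_of_le hx.2 (hxy 2)⟩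

/-- `V` is increasing. [this work] -/
theorem isUpperSet_evV : IsUpperSet evV := fun _ _ hxy hx =>
  hx.elim (fun h => Or.inl ⟨lt_of_lt_of_le h.1 (hxy 2), lt_of_lt_of_le h.2 (hxy 3)⟩)
    fun h => Or.inr ⟨lt_of_lt_of_le h.1 (hxy 0), lt_of_lt_of_le h.2 (hxy 1)⟩

/-- `U` is measurable. [this work] -/
theorem measurableSet_evU : MeasurableSet evU :=
  (measurableSet_lt measurable_const (measurable_pi_apply 0)).inter
    (measurableSet_lt measurable_const (measurable_pi_apply 2))

/-- `V` is measurable. [this work] -/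
theorem measurableSet_evV : MeasurableSet evV :=
  ((measurableSet_lt measurable_const (measurable_pi_apply 2)).inter
    (measurableSet_lt measurable_const (measurable_pi_apply 3))).union
    ((measurableSet_lt measurable_const (measurable_pi_apply 0)).inter
      (measurableSet_lt measurable_const (measurable_pi_apply 1)))

/-- `µ₀(U) = 12` (atoms `1010`, `1111`). [this work] -/
theorem cmsExampleCI₀_evU : cmsExampleCI₀ evU = 12 := by
  classical
  rw [cmsExampleCI₀, natAtomic_apply_filter _ _ measurableSet_evU]
  have hf : (Finset.univ.filter fun k => pt bCI k ∈ evU) =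
      Finset.univ.filter fun k => 1 ≤ bCI k 0 ∧ 1 ≤ bCI k 2 :=
    Finset.filter_congr fun k _ => by simp only [evU, Set.mem_setOf_eq, pt_apply, half_lt_natCast_iff]
  have hs : (∑ k ∈ Finset.univ.filter (fun k => 1 ≤ bCI k 0 ∧ 1 ≤ bCI k 2), wCI k) = 12 := by decide
  rw [hf, hs]; norm_num

/-- `µ₀(V) = 10` (atoms `0011`, `1100`, `1111`). [this work] -/
theorem cmsExampleCI₀_evV : cmsExampleCI₀ evV = 10 := by
  classical
  rw [cmsExampleCI₀, natAtomic_apply_filter _ _ measurableSet_evV]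
  have hf : (Finset.univ.filter fun k => pt bCI k ∈ evV) =
      Finset.univ.filter fun k => (1 ≤ bCI k 2 ∧ 1 ≤ bCI k 3) ∨ (1 ≤ bCI k 0 ∧ 1 ≤ bCI k 1) :=
    Finset.filter_congr fun k _ => by simp only [evV, Set.mem_setOf_eq, pt_apply, half_lt_natCast_iff]
  have hs : (∑ k ∈ Finset.univ.filter (fun k => (1 ≤ bCI k 2 ∧ 1 ≤ bCI k 3) ∨ (1 ≤ bCI k 0 ∧ 1 ≤ bCI k 1)),
      wCI k) = 10 := by decide
  rw [hf, hs]; norm_num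

/-- `µ₀(U ∩ V) = 6` (atom `1111`). [this work] -/
theorem cmsExampleCI₀_evU_inter_evV : cmsExampleCI₀ (evU ∩ evV) = 6 := by
  classical
  rw [cmsExampleCI₀, natAtomic_apply_filter _ _ (measurableSet_evU.inter measurableSet_evV)]
  have hf : (Finset.univ.filter fun k => pt bCI k ∈ evU ∩ evV) =
      Finset.univ.filter fun k => (1 ≤ bCI k 0 ∧ 1 ≤ bCI k 2) ∧
        ((1 ≤ bCI k 2 ∧ 1 ≤ bCI k 3) ∨ (1 ≤ bCI k 0 ∧ 1 ≤ bCI k 1)) :=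
    Finset.filter_congr fun k _ => by
      simp only [evU, evV, Set.mem_inter_iff, Set.mem_setOf_eq, pt_apply, half_lt_natCast_iff]
  have hs : (∑ k ∈ Finset.univ.filter (fun k => (1 ≤ bCI k 0 ∧ 1 ≤ bCI k 2) ∧
      ((1 ≤ bCI k 2 ∧ 1 ≤ bCI k 3) ∨ (1 ≤ bCI k 0 ∧ 1 ≤ bCI k 1))), wCI k) = 6 := by decide
  rw [hf, hs]; norm_num

/-- `µ(U) = 12/19`. [this work] -/
theorem cmsExampleCI_real_evU : cmsExampleCI.real evU = 12 / 19 := by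
  rw [measureReal_def, cmsExampleCI, Measure.smul_apply, smul_eq_mul, cmsExampleCI₀_evU, ENNReal.toReal_mul,
    ENNReal.toReal_inv]
  norm_num

/-- `µ(V) = 10/19`. [this work] -/
theorem cmsExampleCI_real_evV : cmsExampleCI.real evV = 10 / 19 := by
  rw [measureReal_def, cmsExampleCI, Measure.smul_apply, smul_eq_mul, cmsExampleCI₀_evV, ENNReal.toReal_mul,
    ENNReal.toReal_inv]
  norm_num

/-- `µ(U ∩ V) = 6/19`. [this work] -/
theorem cmsExampleCI_real_evU_inter_evV : cmsExampleCI.real (evU ∩ evV) = 6 / 19 := by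
  rw [measureReal_def, cmsExampleCI, Measure.smul_apply, smul_eq_mul, cmsExampleCI₀_evU_inter_evV,
    ENNReal.toReal_mul, ENNReal.toReal_inv]
  norm_num

/-- **The example is not positively associated**: `µ(U) µ(V) = 120/361 > 114/361 = µ(U ∩ V)` for the
increasing events `U`, `V` above — although it is CI in the sense of Definition 4
(`isCIS_cmsExampleCI_perm`); classically CI ⇒ CIS ⇒ associated (Müller–Stoyan, Thm. 3.10.11). [this work] -/
theorem not_isPositivelyAssociated_cmsExampleCI : ¬ IsPositivelyAssociated cmsExampleCI := by
  intro h
  have h' := h.real isUpperSet_evU isUpperSet_evV measurableSet_evU measurableSet_evV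
  rw [cmsExampleCI_real_evU, cmsExampleCI_real_evV, cmsExampleCI_real_evU_inter_evV] at h'
  norm_num at h'

/-- **Summary**: there is a probability law on `ℝ⁴` that is CIS in the sense of Colangelo–Müller–Scarsini's
Definition 4 after EVERY permutation of the coordinates (their CI) and is NOT positively associated. [this work] -/
theorem exists_def4CI_not_isPositivelyAssociated :
    ∃ μ : Measure (Fin 4 → ℝ), IsProbabilityMeasure μ ∧
      (∀ σ : Equiv.Perm (Fin 4), IsCIS (μ.map fun (x : Fin 4 → ℝ) (i : Fin 4) => x (σ i))) ∧
      ¬ IsPositivelyAssociated μ :=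
  ⟨cmsExampleCI, isProbabilityMeasure_cmsExampleCI, isCIS_cmsExampleCI_perm,
    not_isPositivelyAssociated_cmsExampleCI⟩

end NotAssociated

end Summit.CriticalPhenomena.PercolationContinuityZ3.Theorems.SahiCIS
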